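import Summits.Ventures.CertifiedManyBodySolver.Upper.FMPSConsumer
import Summits.Ventures.CertifiedManyBodySolver.Upper.IntervalReaderTransfer

/-!
# Ventures/CertifiedManyBodySolver — Upper/IntervalReaderWitness.lean: what the EXACT sweep computes
(part 6 of the Theorem-H1′ package; parts 1–5: `IntervalReaderSchur`, `IntervalReaderTransfer`,
`IntervalReaderH1`, `IntervalReaderBridge`, `IntervalReaderMoments`)

HONEST FRAMING: first certified bounds; not a superconductivity verdict; every number certified or labelled
float.  Pure multilinear algebra of matrix-product states; no claim about the Hubbard model, a producer, a row or
the thermodynamic limit.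

Theorem H1′ (`IntervalReaderH1.h1_sweep_error_le`) bounds the distance between the reader's COMPUTED environments
and the EXACT ones, the latter being specified only by their recursion
`X (k+1) c = Σ_b transferOp (A k) (O k b c) (X k b)`.  This file identifies the exact environments for the
simplest automaton (ONE state, site operators `O k`): started from the rank-one boundary matrix
`(star l) ⊗ l′` and swept through the sites of a FORMAT-mps1 / METHOD-fmps witness
`ψ = mpsOpenVar L A l r` (site-dependent tensors, `Upper/FMPSConsumer.lean`), the final environment paired with
the right boundary vectors IS the matrix element `⟨ψ_l, (⊗_k O_k) ψ_{l′}⟩`: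

* `inner_mulVec_mpsOpenVar_eq_envSweep` — for site operators `O k` and the product operator `W` with kernel
  `W σ τ = Π_k O k (σ k) (τ k)` (e.g. `W = 1`, an on-site density, a product of on-site densities):
  `star (mpsOpenVar L A l r) ⬝ᵥ (W *ᵥ mpsOpenVar L A l′ r′) = star r ⬝ᵥ (envSweep L A O ((star l) ⊗ l′) *ᵥ r′)`,
  where `envSweep` folds `transferOp (A k) (O k)` over the sites `k = 0, …, L−1` (the bra and ket boundary vectors
  are kept distinct because peeling a site changes them differently on the two sides);
* `star_dotProduct_mpsOpenVar_eq_envSweep` — the NORM: with `O k = 1`,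
  `⟨ψ|ψ⟩ = star r ⬝ᵥ (envSweep L A 1 ((star l) ⊗ l) *ᵥ r)`; each step is then part 2's `transferOp (A k) 1`
  `= Σ_s (A k s)ᴴ · X · A k s` (`transferOp_one`), i.e. the `B = ⟨ψ|ψ⟩` layer of the reader (`h1sweep.py`, the
  `Nrm` chain) computes exactly the quantity the certificate sentence of the FORMAT consumers divides by.

So, for the norm layer and for PHASE B's on-site observables (densities, double occupancies — product operators
in the Jordan–Wigner basis), "the exact environments of Theorem H1′" are not an abstraction: they are these
partial contractions, and `h1_sweep_error_le` + `accept_sound` speak about `⟨ψ|ψ⟩` itself.  The `⟨ψ|H|ψ⟩` layer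
needs in addition that E1's automaton (several states, Jordan–Wigner strings) represents `H` — a property of the
bytes tested in exact integers by `selftest.py`, not formalised here (as recorded in parts 3 and 5).
-/

noncomputable section

open Matrix Finset
open scoped BigOperators ComplexOrder

namespace Summit.Ventures.CertifiedManyBodySolver.Upper.IntervalReader

open Literature.MathematicalPhysics.QuantumLattice

variable {q D : ℕ}

/-! ## §H  Peeling the first site of a site-dependent open MPS -/

/-- No sites: every amplitude of `mpsOpenVar 0 A l r` is `l ⬝ᵥ r`. -/
theorem mpsOpenVar_zero_apply (A : Fin 0 → MPSTensor q D) (l r : Fin D → ℂ) (σ : TensorIndex (Fin 0) q) :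
    mpsOpenVar 0 A l r σ = l ⬝ᵥ r := by
  simp [mpsOpenVar]

/-- Peeling the first site: the amplitude at `(s, τ)` of the `L+1`-site state is the amplitude at `τ` of the
`L`-site state on the remaining tensors with left boundary vector `l ᵥ* A 0 s`. -/
theorem mpsOpenVar_succ_cons (L : ℕ) (A : Fin (L + 1) → MPSTensor q D) (l r : Fin D → ℂ) (s : Fin q)
    (τ : TensorIndex (Fin L) q) :
    mpsOpenVar (L + 1) A l r (Fin.cons s τ : Fin (L + 1) → Fin q) =
      mpsOpenVar L (fun j => A j.succ) (l ᵥ* A 0 s) r τ := by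
  simp only [mpsOpenVar, List.ofFn_succ, List.prod_cons, Fin.cons_zero, Fin.cons_succ, ← mulVec_mulVec,
    dotProduct_mulVec]

/-- Sums over configurations of `L+1` sites split into the first site and the rest. -/
private theorem sum_tensorIndex_succ {M : Type*} [AddCommMonoid M] (L : ℕ)
    (f : TensorIndex (Fin (L + 1)) q → M) :
    ∑ σ, f σ = ∑ s : Fin q, ∑ τ : TensorIndex (Fin L) q, f (Fin.cons s τ : Fin (L + 1) → Fin q) := by
  rw [← Fintype.sum_prod_type']
  exact (Fintype.sum_equiv (Fin.consEquiv fun _ => Fin q) _ _ fun p => rfl).symm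

/-- The product kernel splits off its first factor. -/
private theorem prod_kernel_cons (L : ℕ) (O : Fin (L + 1) → Matrix (Fin q) (Fin q) ℂ) (s s' : Fin q)
    (σ τ : TensorIndex (Fin L) q) :
    ∏ k, O k ((Fin.cons s σ : Fin (L + 1) → Fin q) k) ((Fin.cons s' τ : Fin (L + 1) → Fin q) k) =
      O 0 s s' * ∏ k : Fin L, O k.succ (σ k) (τ k) := by
  rw [Fin.prod_univ_succ]
  simp only [Fin.cons_zero, Fin.cons_succ]

/-! ## §I  The exact environments: `transferOp` folded over the sites -/

/-- `transferOp` is homogeneous in the environment (it is linear; parts 2–3 used additivity only). -/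
theorem transferOp_smul_env (A : MPSTensor q D) (O : Matrix (Fin q) (Fin q) ℂ) (c : ℂ)
    (X : Matrix (Fin D) (Fin D) ℂ) : transferOp A O (c • X) = c • transferOp A O X := by
  unfold transferOp
  rw [Finset.smul_sum]
  refine Finset.sum_congr rfl fun s _ => ?_
  rw [Finset.smul_sum]
  refine Finset.sum_congr rfl fun s' _ => ?_
  rw [Matrix.mul_smul, Matrix.smul_mul, smul_smul, smul_smul, mul_comm]

/-- `transferOp (A k) (O k)` as a `ℂ`-linear map of the environment. -/
def transferOpLin (A : MPSTensor q D) (O : Matrix (Fin q) (Fin q) ℂ) :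
    Matrix (Fin D) (Fin D) ℂ →ₗ[ℂ] Matrix (Fin D) (Fin D) ℂ where
  toFun := transferOp A O
  map_add' X Y := (transferOpHom A O).map_add X Y
  map_smul' c X := transferOp_smul_env A O c X

/-- `transferOpLin` is `transferOp`. -/
@[simp] theorem transferOpLin_apply (A : MPSTensor q D) (O : Matrix (Fin q) (Fin q) ℂ)
    (X : Matrix (Fin D) (Fin D) ℂ) : transferOpLin A O X = transferOp A O X := rfl

/-- **The exact left-to-right environments of the one-state sweep**, as a linear map of the initial (boundary)
matrix: `envSweep 0 = id`, `envSweep (L+1) A O = envSweep L (A ∘ succ) (O ∘ succ) ∘ transferOp (A 0) (O 0)` —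
site `0` is absorbed first, then site `1`, … (the reader's `ltr` direction; `rtl` is the same on the reversed
tensors). -/
def envSweep : (L : ℕ) → (Fin L → MPSTensor q D) → (Fin L → Matrix (Fin q) (Fin q) ℂ) →
    (Matrix (Fin D) (Fin D) ℂ →ₗ[ℂ] Matrix (Fin D) (Fin D) ℂ)
  | 0, _, _ => LinearMap.id
  | L + 1, A, O => (envSweep L (fun j => A j.succ) (fun j => O j.succ)).comp (transferOpLin (A 0) (O 0))

/-- No sites: the environment is the boundary matrix. -/
@[simp] theorem envSweep_zero (A : Fin 0 → MPSTensor q D) (O : Fin 0 → Matrix (Fin q) (Fin q) ℂ)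
    (X : Matrix (Fin D) (Fin D) ℂ) : envSweep 0 A O X = X := rfl

/-- One more site: absorb site `0` with `transferOp`, then sweep the rest. -/
theorem envSweep_succ (L : ℕ) (A : Fin (L + 1) → MPSTensor q D) (O : Fin (L + 1) → Matrix (Fin q) (Fin q) ℂ)
    (X : Matrix (Fin D) (Fin D) ℂ) :
    envSweep (L + 1) A O X = envSweep L (fun j => A j.succ) (fun j => O j.succ) (transferOp (A 0) (O 0) X) :=
  rfl

/-- The boundary matrices after peeling site `0` recombine into one `transferOp` step:
`Σ_{s,s′} O s s′ • (star (l ᵥ* A s)) ⊗ (l′ ᵥ* A s′) = transferOp A O ((star l) ⊗ l′)`. -/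
theorem sum_smul_vecMulVec_vecMul_eq_transferOp (A : MPSTensor q D) (O : Matrix (Fin q) (Fin q) ℂ)
    (l l' : Fin D → ℂ) :
    ∑ s, ∑ s', O s s' • vecMulVec (star (l ᵥ* A s)) (l' ᵥ* A s') =
      transferOp A O (vecMulVec (star l) l') := by
  unfold transferOp
  refine Finset.sum_congr rfl fun s _ => Finset.sum_congr rfl fun s' _ => ?_
  rw [mul_vecMulVec, vecMulVec_mul, mulVec_conjTranspose, star_star]

/-! ## §J  The matrix element of a product operator between two open MPS = the swept boundary pairing -/

/-- **What the exact sweep computes.**  For site-dependent tensors `A`, site operators `O k` and the product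
operator `W` on configurations with kernel `W σ τ = Π_k O k (σ k) (τ k)`, and boundary vectors `l, l′, r, r′`:
`star (mpsOpenVar L A l r) ⬝ᵥ (W *ᵥ mpsOpenVar L A l′ r′) = star r ⬝ᵥ (envSweep L A O ((star l) ⊗ l′) *ᵥ r′)`.
(Induction on `L`, peeling site `0`: the four boundary pieces recombine by
`sum_smul_vecMulVec_vecMul_eq_transferOp` and the linearity of `envSweep`.) -/
theorem inner_mulVec_mpsOpenVar_eq_envSweep : ∀ (L : ℕ) (A : Fin L → MPSTensor q D)
    (O : Fin L → Matrix (Fin q) (Fin q) ℂ) (W : Op (Fin L) q)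
    (_hW : ∀ σ τ, W σ τ = ∏ k, O k (σ k) (τ k)) (l l' r r' : Fin D → ℂ),
    star (mpsOpenVar L A l r) ⬝ᵥ (W *ᵥ mpsOpenVar L A l' r') =
      star r ⬝ᵥ (envSweep L A O (vecMulVec (star l) l') *ᵥ r')
  | 0, A, O, W, hW, l, l', r, r' => by
    -- both sides are `star (l ⬝ᵥ r) * (l′ ⬝ᵥ r′)`
    have hK : ∀ σ τ : TensorIndex (Fin 0) q, W σ τ = 1 := fun σ τ => by
      rw [hW, Fin.prod_univ_zero]
    have hψ : mpsOpenVar 0 A l r = fun _ => l ⬝ᵥ r := funext (mpsOpenVar_zero_apply A l r)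
    have hWψ' : W *ᵥ mpsOpenVar 0 A l' r' = fun _ => l' ⬝ᵥ r' := by
      funext σ
      change ∑ τ, W σ τ * mpsOpenVar 0 A l' r' τ = l' ⬝ᵥ r'
      rw [Fintype.sum_unique, hK, one_mul, mpsOpenVar_zero_apply]
    have hL : star (mpsOpenVar 0 A l r) ⬝ᵥ (W *ᵥ mpsOpenVar 0 A l' r') = star (l ⬝ᵥ r) * (l' ⬝ᵥ r') := by
      rw [hWψ', hψ]
      change ∑ σ : TensorIndex (Fin 0) q, star (l ⬝ᵥ r) * (l' ⬝ᵥ r') = _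
      rw [Fintype.sum_unique]
    have hR : star r ⬝ᵥ (vecMulVec (star l) l' *ᵥ r') = star (l ⬝ᵥ r) * (l' ⬝ᵥ r') := by
      have hv : vecMulVec (star l) l' *ᵥ r' = (l' ⬝ᵥ r') • star l := by
        ext i
        simp only [mulVec, dotProduct, vecMulVec_apply, Pi.smul_apply, Pi.star_apply, smul_eq_mul,
          Finset.sum_mul, mul_assoc, mul_comm (star (l i))]
      rw [hv, dotProduct_smul, star_dotProduct_star, smul_eq_mul, mul_comm]
    rw [envSweep_zero, hL, hR]
  | L + 1, A, O, W, hW, l, l', r, r' => by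
    -- the `L`-site data after peeling site `0`: tensors `A ∘ succ`, operators `O ∘ succ`, kernel `W′`
    have hW' : ∀ σ τ : TensorIndex (Fin L) q,
        (Matrix.of fun σ τ : TensorIndex (Fin L) q => ∏ k, O k.succ (σ k) (τ k)) σ τ =
          ∏ k, O k.succ (σ k) (τ k) := fun σ τ => rfl
    have ih := fun (s s' : Fin q) =>
      inner_mulVec_mpsOpenVar_eq_envSweep L (fun j => A j.succ) (fun j => O j.succ) _ hW'
        (l ᵥ* A 0 s) (l' ᵥ* A 0 s') r r'
    -- (1) the left-hand side, peeled: `Σ_{s,s′} O 0 s s′ · ⟨ψ_L[l ᵥ* A 0 s], W′ ψ_L[l′ ᵥ* A 0 s′]⟩`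
    have hLHS : star (mpsOpenVar (L + 1) A l r) ⬝ᵥ (W *ᵥ mpsOpenVar (L + 1) A l' r') =
        ∑ s, ∑ s', O 0 s s' * (star (mpsOpenVar L (fun j => A j.succ) (l ᵥ* A 0 s) r) ⬝ᵥ
          ((Matrix.of fun σ τ : TensorIndex (Fin L) q => ∏ k, O k.succ (σ k) (τ k)) *ᵥ
            mpsOpenVar L (fun j => A j.succ) (l' ᵥ* A 0 s') r')) := by
      simp only [dotProduct, mulVec, Pi.star_apply, hW, Matrix.of_apply]
      rw [sum_tensorIndex_succ]
      refine Finset.sum_congr rfl fun s _ => ?_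
      simp only [sum_tensorIndex_succ L (fun τ => (∏ k, O k _ (τ k)) * mpsOpenVar (L + 1) A l' r' τ),
        prod_kernel_cons, mpsOpenVar_succ_cons]
      -- `Σ_σ′ a σ′ · Σ_s′ Σ_τ′ (O₀ s s′ · k σ′ τ′) · b_{s′} τ′ = Σ_s′ O₀ s s′ · Σ_σ′ a σ′ · Σ_τ′ k σ′ τ′ · b_{s′} τ′`
      simp only [Finset.mul_sum]
      rw [Finset.sum_comm]
      refine Finset.sum_congr rfl fun s' _ => Finset.sum_congr rfl fun σ' _ => Finset.sum_congr rfl fun τ' _ => ?_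
      ring
    -- (2) the right-hand side, peeled: linearity of the sweep over the recombined boundary matrix
    have hRHS : star r ⬝ᵥ (envSweep (L + 1) A O (vecMulVec (star l) l') *ᵥ r') =
        ∑ s, ∑ s', O 0 s s' * (star r ⬝ᵥ
          (envSweep L (fun j => A j.succ) (fun j => O j.succ)
            (vecMulVec (star (l ᵥ* A 0 s)) (l' ᵥ* A 0 s')) *ᵥ r')) := by
      rw [envSweep_succ, ← sum_smul_vecMulVec_vecMul_eq_transferOp, map_sum]
      simp only [map_sum, map_smul, Matrix.sum_mulVec, Matrix.smul_mulVec, dotProduct_sum,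
        dotProduct_smul, smul_eq_mul]
    rw [hLHS, hRHS]
    refine Finset.sum_congr rfl fun s _ => Finset.sum_congr rfl fun s' _ => ?_
    rw [ih s s']

/-- **The norm layer.**  With the identity site operators the product operator is `1`, so
`⟨ψ|ψ⟩ = star r ⬝ᵥ (envSweep L A 1 ((star l) ⊗ l) *ᵥ r)` for `ψ = mpsOpenVar L A l r`: the exact `Nrm` chain of
the reader (each step `transferOp (A k) 1 X = Σ_s (A k s)ᴴ X (A k s)`, part 2's `transferOp_one`) ends in the
squared norm that the certificate sentence `Re ⟨ψ, H ψ⟩ ≤ E · Re ⟨ψ, ψ⟩` of the FORMAT consumers divides by. -/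
theorem star_dotProduct_mpsOpenVar_eq_envSweep (L : ℕ) (A : Fin L → MPSTensor q D) (l r : Fin D → ℂ) :
    star (mpsOpenVar L A l r) ⬝ᵥ mpsOpenVar L A l r =
      star r ⬝ᵥ (envSweep L A (fun _ => (1 : Matrix (Fin q) (Fin q) ℂ)) (vecMulVec (star l) l) *ᵥ r) := by
  have h := inner_mulVec_mpsOpenVar_eq_envSweep L A (fun _ => (1 : Matrix (Fin q) (Fin q) ℂ)) 1
    (fun σ τ => ?_) l l r r
  · rwa [one_mulVec] at h
  · -- the kernel of the identity: `1 σ τ = Π_k 1 (σ k) (τ k)`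
    by_cases hστ : σ = τ
    · subst hστ
      simp
    · rw [Matrix.one_apply_ne hστ]
      obtain ⟨k, hk⟩ := Function.ne_iff.mp hστ
      have h1 : (1 : Matrix (Fin q) (Fin q) ℂ) (σ k) (τ k) = 0 := Matrix.one_apply_ne hk
      exact (Finset.prod_eq_zero (Finset.mem_univ k) h1).symm

/-! ## §J′  Reading right-to-left: reversed, transposed tensors give the same amplitudes
(the reader sweeps in the better-conditioned direction, `h1sweep.py` `use_rev`; appended 2026-08-27) -/

/-- `(List.ofFn f).reverse = List.ofFn (f ∘ Fin.rev)`. -/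
private theorem reverse_ofFn {α : Type*} {n : ℕ} (f : Fin n → α) :
    (List.ofFn f).reverse = List.ofFn fun i => f (Fin.rev i) := by
  apply List.ext_getElem
  · simp
  · intro i h1 h2
    simp only [List.getElem_reverse, List.getElem_ofFn, List.length_ofFn]
    congr 1
    ext
    simp only [Fin.val_rev]
    omega

/-- **The `rtl` read is the `ltr` read of the reversed witness.**  Reversing the site order, transposing every
slice and swapping the boundary vectors gives the same amplitudes on the reversed configurations:
`ψ[A, l, r](σ) = ψ[j ↦ (A (rev j))ᵀ, r, l](σ ∘ rev)` — so every identity of this package applies verbatim to the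
reader's right-to-left sweep (`(M₀ ⋯ M_{L−1})ᵀ = M_{L−1}ᵀ ⋯ M₀ᵀ`, `l ⬝ᵥ (M *ᵥ r) = r ⬝ᵥ (Mᵀ *ᵥ l)`). -/
theorem mpsOpenVar_reverse (L : ℕ) (A : Fin L → MPSTensor q D) (l r : Fin D → ℂ) (σ : TensorIndex (Fin L) q) :
    mpsOpenVar L A l r σ =
      mpsOpenVar L (fun j => fun s => (A (Fin.rev j) s)ᵀ) r l (fun i => σ (Fin.rev i)) := by
  simp only [mpsOpenVar]
  rw [dotProduct_mulVec, ← mulVec_transpose, dotProduct_comm, Matrix.transpose_list_prod, List.map_ofFn,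
    reverse_ofFn]
  rfl

end Summit.Ventures.CertifiedManyBodySolver.Upper.IntervalReader

end
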